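/-
Copyright: cell pub-balaban-gaps (YM BLITZ Y1, track G1), seat g1-p2 GEN 6 (unit `pub-balaban-gaps-g1-p2`).  Row (D4) NODE O,
OBJECT ∕ MECHANISM level: the PINNED-RATE forms of the one-scale ENDs of files 45 and 47 (walk rate in the type instead of `∃ ρ′`),
for consumers that multiply ∕ perturb the expansion again (the tail step, file 49).  HONEST FRAMING: packaging at MODEL generality;
nothing of Bałaban's constructed or asserted; (D4) NOT discharged (instance 0∕1); NOT BetaPertH, NOT continuum, NOT Clay.
-/
import Summits.QuantumFields.BalabanUV.Gaps.D4WalkBlockAccretiveDecay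

/-!
# `Gaps.D4WalkBlockAccretiveRate` — 45's and 47's one-scale ENDs with the walk rate `ρ₀ − 3μ − κ₁P∕r₀` exposed
# (cell pub-balaban-gaps, seat g1-p2 GEN 6)

HONEST DEPENDENCY (cell pub-balaban, verbatim): continuum YM on T⁴ ⇐ BetaPertH ∧ nine spine estimates (0/9 proved);
BetaPertH ⇐ (D1) ∧ (D4) ∧ CAP+tail.

WHY.  `Gaps/D4WalkBlockParametrixDecay.blockWalkExpansion_print_parametrix` (45) and
`Gaps/D4WalkBlockAccretiveDecay.blockWalkExpansion_accretive_print` (47) conclude `∃ … ρ′ …, BlockWalkExpansion … ρ′`: the walk rate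
of the decorated expansion — `ρ₀ − 3μ − κ₁P∕r₀`, the value 44 computes — is hidden.  Every consumer that MULTIPLIES or PERTURBS the
expansion again (`Gaps/D4WalkBlockProduct.blockWalkExpansion_mul`: `ρ + σ ≤ ρ₁`, `ρ₁ − ε₁ ≤ ρ − ε`; the resolvent ∕ tail step
`Gaps/D4WalkBlockTail.blockWalkExpansion_tail`: `κ_W + μ ≤ ρ_W − ε_W`, `ρ_W + μ ≤ ρ_V`) needs it from both sides.  THIS FILE re-runs
the two compositions through 44's appended `blockWalkExpansion_oneScale_print_rate` (v1.1): `print_parametrix_rate` (= 45's END,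
rate pinned), `accretive_print_rate` (= 47's END, rate pinned) — identical hypotheses, identical constants, proofs = the originals'
five-line compositions BY NAME.  Nothing else.  Value: bookkeeping; words of row (D4) UNCHANGED.

References: T. Bałaban, Comm. Math. Phys. 99 (1985) 389–434 [B9], Thms 3.1–3.3 (3.42) p.397, p.399, Cor 3.6 p.408, Thm 3.7
(3.87)–(3.90) p.409, Cor 3.8 p.410, Thm 3.10 (3.107)–(3.108) p.416; Comm. Math. Phys. 116 (1988) 1–22 [II], p.3, (1.11) p.5,
p.13, p.15, (2.16) p.16.
-/

noncomputable section

namespace Summit.QuantumFields.BalabanUV.Gaps.D4WalkBlockAccretiveRate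

open Metric Set Finset
open Literature.MathematicalPhysics.QuantumFieldTheory.Balaban1983to89
open Literature.MathematicalPhysics.QuantumFieldTheory.Balaban1983to89.B9SectDWalk (DomBy)
open Literature.MathematicalPhysics.QuantumFieldTheory.Balaban1983to89.B9Thm34Ext (toB6)
open Literature.MathematicalPhysics.QuantumFieldTheory.Balaban1983to89.B9Thm37GlueTorus (torusGeom tdist1 tdist1_nonneg)
open Literature.MathematicalPhysics.QuantumFieldTheory.Balaban1983to89.TreeLengthTorus (TPt)
open Literature.MathematicalPhysics.QuantumFieldTheory.Balaban1983to89.B5TorusCover (UT)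
open Literature.MathematicalPhysics.QuantumFieldTheory.Balaban1983to89.B11SectG (RowSum)
open Literature.MathematicalPhysics.QuantumFieldTheory.Balaban1983to89.B5Prop11Lower (nsq)
open Literature.MathematicalPhysics.QuantumFieldTheory.Balaban1983to89.B13DomainKernelWalks (DomainTerms)
open Summit.QuantumFields.BalabanUV.Gaps.D4WalkBlock (blockNorm BlockWalkExpansion)
open Summit.QuantumFields.BalabanUV.Gaps.D4WalkBlockCommutator (comm_blocks_subset)
open Summit.QuantumFields.BalabanUV.Gaps.D4WalkBlockLocalInverse (differentiableOn_locInv)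
open Summit.QuantumFields.BalabanUV.Gaps.D4WalkBlockDecorate (decTerm decKernel)
open Summit.QuantumFields.BalabanUV.Gaps.D4WalkBlockOneScalePrint (blockWalkExpansion_oneScale_print_rate)
open Summit.QuantumFields.BalabanUV.Gaps.D4WalkBlockParametrixDecay (isDomainLocalBD_seed isDomainLocalBD_step)
open Summit.QuantumFields.BalabanUV.Gaps.D4WalkBlockAccretiveDecay (blockNorm_locInv_le_decay blockNorm_comm_le_decay)
open Summit.QuantumFields.BalabanUV.T4Continuum.Spine.NE5.TwoRunPencilDomains (withOp)
open Summit.QuantumFields.BalabanUV.Beta.UnitLatticeWalkInversion (Hd)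
open Summit.QuantumFields.BalabanUV.Beta.UnitLatticeLocalInverse (compress extend)
open Summit.QuantumFields.BalabanUV.Beta.AccretiveCombesThomas (conjForm)

variable {ν : ℕ} {K : Fin ν → ℕ} [∀ i, NeZero (K i)]
variable {n : Type} [Fintype n] [DecidableEq n]

/-! ## §1. 45's END, rate pinned -/

section Rates

variable {d N' : ℕ}
variable {E : Type*} [NormedAddCommGroup E] [NormedSpace ℂ E]
variable {L : DomainTerms d N' ν K n n E} {h : L.B → n → ℝ} {Es : L.B → Finset n} {K' : E → Matrix n n ℂ}
variable {c₀ c : B13.Consts} {cubn : n → UT K} {X : Finset (UT K)} {R CL lamK r : ℝ} {nD nC : ℕ}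
variable {ρ₀ ε₀ κ₀ μ cμ : ℝ}

/-- **45's END WITH THE WALK RATE EXPOSED**: `Gaps/D4WalkBlockParametrixDecay.blockWalkExpansion_print_parametrix` composed through
44's `blockWalkExpansion_oneScale_print_rate` — identical hypotheses, the walk rate `ρ₀ − 3μ − κ₁P∕r₀` in the type.
[cite: Balaban1988RG2Cluster, p.3, (1.11) p.5, p.13, p.15, (2.16) p.16; Balaban1985BackgroundPropagators, (3.42) p.399, Thm 3.7 (3.87)–(3.90) p.409, Cor 3.8 p.410, Thm 3.10 (3.107)–(3.108) p.416] -/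
theorem print_parametrix_rate
    (hanchor : ∀ b, L.anchor b ∈ L.dom b) (hdiam : ∀ b, ∀ z ∈ L.dom b, ∀ z' ∈ L.dom b, tdist1 K z z' ≤ r)
    (hJ0 : ∀ b, L.J b = ∅) (hmult : ∀ z : UT K, (Finset.univ.filter fun b => L.anchor b = z).card ≤ nD)
    (hsupp : ∀ b y, y ∉ Es b → h b y = 0) (habs : ∀ b y, |h b y| ≤ 1) (hE : ∀ b y, y ∈ Es b → cubn y ∈ L.dom b)
    (hLan : ∀ b i j, DifferentiableOn ℂ (fun u => L.op b u i j) (ball (0 : E) R))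
    (hLbdD : ∀ b, ∀ u ∈ ball (0 : E) R, ∀ y y',
      blockNorm cubn cubn (L.op b u) y y' ≤ CL * Real.exp (-(ρ₀ * tdist1 K y y')))
    (hCL : 0 ≤ CL)
    (hKan : ∀ i j, DifferentiableOn ℂ (fun u => K' u i j) (ball (0 : E) R))
    (hKbdD : ∀ b, ∀ u ∈ ball (0 : E) R, ∀ y y'',
      blockNorm cubn cubn (Hd h b * K' u - K' u * Hd h b) y y'' ≤ lamK * Real.exp (-(ρ₀ * tdist1 K y y'')))
    (hlamK : 0 ≤ lamK)
    (hKsupp : ∀ b u y y', blockNorm cubn cubn (Hd h b * K' u - K' u * Hd h b) y y' ≠ 0 → y ∈ L.dom b ∧ y' ∈ L.dom b)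
    (hcard : ∀ b, (L.dom b).card ≤ nC)
    (hκ₁₀ : 0 ≤ c₀.κ₁) (hr : 0 ≤ r) (hμ : 0 ≤ μ) (hμε : 3 * μ ≤ ε₀) (hμκ : 2 * μ ≤ κ₀) (hwin : κ₀ + μ ≤ ρ₀ - ε₀)
    (hcμ : 0 ≤ cμ) (hrow : RowSum (toB6 (torusGeom K 0 0 0) 0 True) μ cμ)
    (hq : cμ * (cμ * 1 * (1 * (((nC * lamK * CL) * Real.exp (c₀.κ₁ * (0 : ℕ))) * Real.exp (μ * r) * (nD * cμ))) * cμ) *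
      cμ < 1)
    (cellOf : UT K → TPt d N') (J' : L.B → Finset (TPt d N')) (hJ' : ∀ b, J' b ⊆ (L.dom b).image cellOf)
    (hJ'X : ∀ b, (J' b).Nonempty → (L.dom b ∩ X).Nonempty) {P : ℕ} {r₀ Rb : ℝ} (hr₀ : 0 < r₀) (hRD : r₀ + r ≤ Rb)
    (hpack : ∀ a : UT K, ∃ S : Finset (TPt d N'), S.card ≤ P ∧ ∀ z, tdist1 K a z ≤ Rb → cellOf z ∈ S)
    (hκ₁ : 0 ≤ c.κ₁) (hshift : c.κ₁ * (P / r₀) ≤ ε₀ - 3 * μ) :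
    ∃ (W : Type) (T : W → (TPt d N' → ℂ) → E → Matrix n n ℂ) (A : W → ℝ) (D : W → UT K → UT K → ℝ)
      (dec : W → Finset (TPt d N')),
      BlockWalkExpansion c cubn cubn (decKernel T dec) X R (ε₀ - 3 * μ - c.κ₁ * (P / r₀)) (κ₀ - 2 * μ)
        (Real.exp (c.κ₁ * P) * (Real.exp ((ε₀ - 3 * μ) * (2 * r)) *
          (cμ * ((CL * Real.exp (c₀.κ₁ * (0 : ℕ))) * Real.exp (μ * r) * (nD * cμ)) *
            (1 * (1 - cμ * (cμ * 1 * (1 * (((nC * lamK * CL) * Real.exp (c₀.κ₁ * (0 : ℕ))) * Real.exp (μ * r) *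
              (nD * cμ))) * cμ) * cμ)⁻¹) * cμ)))
        (decTerm T dec) {w | (dec w).Nonempty} A D (ρ₀ - 3 * μ - c.κ₁ * (P / r₀)) ∧
      (∀ u ∈ ball (0 : E) R, decKernel T dec (fun _ => 1) u =
        (withOp L fun b u => Hd h b * L.op b u * Hd h b).kernel (fun _ => 1) u *
          ((1 : Matrix n n ℂ) + (-1 : ℂ) •
            (withOp L fun b u => (Hd h b * K' u - K' u * Hd h b) * L.op b u * Hd h b).kernel (fun _ => 1) u)⁻¹) ∧
      ∀ ω, DomBy (toB6 (torusGeom K 0 0 0) 0 True) (D ω) :=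
  have hρ₀ : 0 ≤ ρ₀ := by linarith
  blockWalkExpansion_oneScale_print_rate
    (isDomainLocalBD_seed hanchor hdiam hJ0 hmult hsupp habs hE hLan hLbdD hCL hρ₀)
    (isDomainLocalBD_step hanchor hdiam hJ0 hmult hsupp habs hE hLan hLbdD hCL hρ₀ hKan hKbdD hlamK hKsupp hcard)
    hκ₁₀ hCL (by positivity) hr hμ hμε hμκ hwin hcμ hrow hq cellOf J' hJ' hJ'X hr₀ hRD hpack hκ₁ hshift

end Rates

/-! ## §2. 47's END, rate pinned -/

section RatesAccretive

variable {d N' : ℕ} {B : Type}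
variable {E : Type*} [NormedAddCommGroup E] [NormedSpace ℂ E]
variable {L₀ : DomainTerms d N' ν K n n E} {h : L₀.B → n → ℝ} {Es : L₀.B → Finset n} {K' : E → Matrix n n ℂ}
variable {ds : n → n → ℝ}
variable {c₀ c : B13.Consts} {cubn : n → UT K} {X : Finset (UT K)} {R CK M m κc κ' cs' r₁ r : ℝ} {nD nC : ℕ}
variable {ρ₀ ε₀ κ₀ μ cμ : ℝ}

/-- **47's END WITH THE WALK RATE EXPOSED**: `Gaps/D4WalkBlockAccretiveDecay.blockWalkExpansion_accretive_print` (local inverses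
CONSTRUCTED from uniform conjugated coercivity, decay kept) through §1's `print_parametrix_rate` — identical hypotheses, the walk
rate `ρ₀ − 3μ − κ₁P∕r₀` in the type.
[cite: Balaban1988RG2Cluster, p.3, (1.11) p.5, p.13, p.15; Balaban1985BackgroundPropagators, Thms 3.1–3.3 (3.42) p.397, p.399, Cor 3.6 p.408, Thm 3.7 (3.87)–(3.90) p.409, Cor 3.8 p.410, Thm 3.10 (3.107)–(3.108) p.416] -/
theorem accretive_print_rate
    (hanchor : ∀ b, L₀.anchor b ∈ L₀.dom b) (hdiam : ∀ b, ∀ z ∈ L₀.dom b, ∀ z' ∈ L₀.dom b, tdist1 K z z' ≤ r)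
    (hJ0 : ∀ b, L₀.J b = ∅) (hmult : ∀ z : UT K, (Finset.univ.filter fun b => L₀.anchor b = z).card ≤ nD)
    (hsupp : ∀ b y, y ∉ Es b → h b y = 0) (habs : ∀ b y, |h b y| ≤ 1) (hE : ∀ b y, y ∈ Es b → cubn y ∈ L₀.dom b)
    (hKan : ∀ i j, DifferentiableOn ℂ (fun u => K' u i j) (ball (0 : E) R))
    (hKbd : ∀ u ∈ ball (0 : E) R, ∀ y y', blockNorm cubn cubn (K' u) y y' ≤ CK) (hCK : 0 ≤ CK)
    (hM : 0 < M) (hr₁ : 0 ≤ r₁) (hsymm : ∀ i j, ds i j = ds j i) (hd0 : ∀ j, ds j j = 0)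
    (hLip : ∀ b i j, |h b i - h b j| ≤ ds i j / M) (hKrange : ∀ u i j, K' u i j ≠ 0 → ds i j ≤ r₁)
    (hdomE : ∀ b i, (∃ k ∈ Es b, ds i k ≤ r₁) → cubn i ∈ L₀.dom b)
    (hcard : ∀ b, (L₀.dom b).card ≤ nC)
    (hm : 0 < m) (hκc : 0 ≤ κc)
    (hcoer : ∀ u ∈ ball (0 : E) R, ∀ j, ∀ z : n → ℂ, m * nsq z ≤ (conjForm (1 + K' u) κc (fun e => ds e j) z).re)
    (hκ' : 0 ≤ κ') (hcmp : ∀ i j, ρ₀ * tdist1 K (cubn i) (cubn j) ≤ κ' * ds i j)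
    (hcs' : 0 ≤ cs') (hsite' : ∀ i, ∑ j, Real.exp (-((κc - κ') * ds i j)) ≤ cs')
    (hκ₁₀ : 0 ≤ c₀.κ₁) (hr : 0 ≤ r) (hμ : 0 ≤ μ) (hμε : 3 * μ ≤ ε₀) (hμκ : 2 * μ ≤ κ₀) (hwin : κ₀ + μ ≤ ρ₀ - ε₀)
    (hcμ : 0 ≤ cμ) (hrow : RowSum (toB6 (torusGeom K 0 0 0) 0 True) μ cμ)
    (hq : cμ * (cμ * 1 * (1 * (((nC * (r₁ / M * CK * Real.exp (κ' * r₁)) * (cs' / m)) * Real.exp (c₀.κ₁ * (0 : ℕ))) *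
      Real.exp (μ * r) * (nD * cμ))) * cμ) * cμ < 1)
    (cellOf : UT K → TPt d N') (J' : L₀.B → Finset (TPt d N')) (hJ' : ∀ b, J' b ⊆ (L₀.dom b).image cellOf)
    (hJ'X : ∀ b, (J' b).Nonempty → (L₀.dom b ∩ X).Nonempty) {P : ℕ} {r₀ Rb : ℝ} (hr₀ : 0 < r₀) (hRD : r₀ + r ≤ Rb)
    (hpack : ∀ a : UT K, ∃ S : Finset (TPt d N'), S.card ≤ P ∧ ∀ z, tdist1 K a z ≤ Rb → cellOf z ∈ S)
    (hκ₁ : 0 ≤ c.κ₁) (hshift : c.κ₁ * (P / r₀) ≤ ε₀ - 3 * μ) :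
    ∃ (W : Type) (T : W → (TPt d N' → ℂ) → E → Matrix n n ℂ) (A : W → ℝ) (D : W → UT K → UT K → ℝ)
      (dec : W → Finset (TPt d N')),
      BlockWalkExpansion c cubn cubn (decKernel T dec) X R (ε₀ - 3 * μ - c.κ₁ * (P / r₀)) (κ₀ - 2 * μ)
        (Real.exp (c.κ₁ * P) * (Real.exp ((ε₀ - 3 * μ) * (2 * r)) *
          (cμ * (((cs' / m) * Real.exp (c₀.κ₁ * (0 : ℕ))) * Real.exp (μ * r) * (nD * cμ)) *
            (1 * (1 - cμ * (cμ * 1 * (1 * (((nC * (r₁ / M * CK * Real.exp (κ' * r₁)) * (cs' / m)) *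
              Real.exp (c₀.κ₁ * (0 : ℕ))) * Real.exp (μ * r) * (nD * cμ))) * cμ) * cμ)⁻¹) * cμ)))
        (decTerm T dec) {w | (dec w).Nonempty} A D (ρ₀ - 3 * μ - c.κ₁ * (P / r₀)) ∧
      (∀ u ∈ ball (0 : E) R, decKernel T dec (fun _ => 1) u =
        (withOp L₀ fun b u => Hd h b * extend (compress (1 + K' u) (Es b))⁻¹ * Hd h b).kernel (fun _ => 1) u *
          ((1 : Matrix n n ℂ) + (-1 : ℂ) •
            (withOp L₀ fun b u =>
              (Hd h b * K' u - K' u * Hd h b) * extend (compress (1 + K' u) (Es b))⁻¹ * Hd h b).kernel (fun _ => 1) u)⁻¹) ∧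
      ∀ ω, DomBy (toB6 (torusGeom K 0 0 0) 0 True) (D ω) :=
  print_parametrix_rate (L := withOp L₀ fun b u => extend (compress (1 + K' u) (Es b))⁻¹)
    hanchor hdiam hJ0 hmult hsupp habs hE
    (fun b i j => differentiableOn_locInv (Es b) ds hm
      (fun k l => by
        simp only [Matrix.add_apply]
        exact (differentiableOn_const _).add (hKan k l)) hcoer i j)
    (fun b u hu y y' => blockNorm_locInv_le_decay cubn (1 + K' u) (Es b) ds hd0 hκc hm (hcoer u hu) hcmp hcs' hsite' y y')
    (div_nonneg hcs' hm.le) hKan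
    (fun b u hu y y'' => blockNorm_comm_le_decay cubn h ds hM hr₁ hLip (K' u) (hKrange u) (hKbd u hu) hCK hκ' hcmp b y y'')
    (by positivity)
    (fun b u y y' hne => comm_blocks_subset cubn h Es hsupp ds hsymm (fun i => by rw [hd0]; exact hr₁)
      (K' u) (hKrange u) L₀.dom hdomE b y y' hne)
    hcard hκ₁₀ hr hμ hμε hμκ hwin hcμ hrow hq cellOf J' hJ' hJ'X hr₀ hRD hpack hκ₁ hshift

end RatesAccretive

end Summit.QuantumFields.BalabanUV.Gaps.D4WalkBlockAccretiveRate

end
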